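import Summits.ValiantsHypothesis.ValiantsHypothesis.Theses.SOSTau

/-!
# Crux `SOSTau.SOSTau` (stmt-ValiantsHypothesis-18748), line `Sketch` — registered stub
`stub_gaussPair` (G): TWO INEQUALITIES FOR A GAUSSIAN PAIR OF LINEAR FUNCTIONALS

**Claim settled** (TRUE).  Let `c` be standard Gaussian on `EuclideanSpace ℝ (Fin n)`
(`ProbabilityTheory.stdGaussian`) and `U ⊥ V` with `U ≠ 0`; put `X = ⟪c, U⟫`, `Y = ⟪c, V⟫`.
* If `‖U‖ = ‖V‖` then `P[X² < Y²] ≥ 1/2`.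
* There is an absolute `κ > 0` such that `‖U‖² ≥ 3‖V‖²` implies `P[Y² < X²] ≥ 1/2 + κ`.

Proof.  (1) JOINT LAW (`gaussPair_jointLaw`): `c ↦ (⟪U, c⟫, ⟪V, c⟫)` is a continuous linear map,
so the pair is jointly Gaussian; its covariance is
`covarianceBilin (stdGaussian _) U V = ⟪U, V⟫ = 0`, hence the two coordinates are independent
(`HasGaussianLaw.indepFun_of_covariance_eq_zero`) and the joint law is the product of the
marginals `gaussianReal 0 ‖U‖²`, `gaussianReal 0 ‖V‖²`, i.e. the image of `γ ⊗ γ`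
(`γ = gaussianReal 0 1`) under `(x, y) ↦ (‖U‖ x, ‖V‖ y)`.
(2) ON `ℝ × ℝ`: ties `{x² = y²}` are `γ ⊗ γ`-null (each vertical section is `{x, -x}` and `γ` has
no atoms) and `Prod.swap` preserves `γ ⊗ γ`, so `γ ⊗ γ {x² < y²} = γ ⊗ γ {y² < x²} ≥ 1/2`; and
`{y² < 3x²} ⊇ {y² < x²} ∪ [1, 6/5] × [6/5, 17/10]` (disjoint), so with
`κ = γ [1, 6/5] · γ [6/5, 17/10] > 0` (`volume ≪ γ`) we get `γ ⊗ γ {y² < 3x²} ≥ 1/2 + κ`.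
(3) PULL BACK: for `‖U‖ = ‖V‖ > 0` the event `{(‖U‖x)² < (‖U‖y)²}` is `{x² < y²}`; for
`3‖V‖² ≤ ‖U‖²`, `‖U‖ > 0` the event `{(‖V‖y)² < (‖U‖x)²}` contains `{y² < 3x²}`.

Unconditional (axioms `propext`, `Classical.choice`, `Quot.sound`); Mathlib only
(`stdGaussian`, `HasGaussianLaw`, `gaussianReal`, `Measure.prod`).
-/

-- layout Summits/ValiantsHypothesis/ValiantsHypothesis forces the duplicated namespace component
set_option linter.dupNamespace false

namespace Summit.ValiantsHypothesis.ValiantsHypothesis.Theorems.SOSTauSOSTau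

open MeasureTheory ProbabilityTheory
open scoped RealInnerProductSpace

/-! ### The standard Gaussian pair `γ ⊗ γ` on `ℝ × ℝ` (`γ = gaussianReal 0 1`) -/

/-- Ties `x² = y²` are null for `γ ⊗ γ`: every vertical section is the finite set `{x, -x}`. -/
theorem gaussPair_tie_null :
    ((gaussianReal 0 1).prod (gaussianReal 0 1)) {q : ℝ × ℝ | q.1 ^ 2 = q.2 ^ 2} = 0 := by
  have hD : MeasurableSet {q : ℝ × ℝ | q.1 ^ 2 = q.2 ^ 2} :=
    measurableSet_eq_fun (by fun_prop) (by fun_prop)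
  have : NullSingletonClass (gaussianReal 0 1) := nullSingletonClass_gaussianReal one_ne_zero
  have h0 : ∀ x : ℝ, gaussianReal 0 1 (Prod.mk x ⁻¹' {q : ℝ × ℝ | q.1 ^ 2 = q.2 ^ 2}) = 0 := by
    intro x
    refine measure_mono_null (t := {x, -x}) (fun y hy => ?_) ((Set.toFinite _).measure_zero _)
    simp only [Set.mem_preimage, Set.mem_setOf_eq] at hy
    simp only [Set.mem_insert_iff, Set.mem_singleton_iff]
    exact sq_eq_sq_iff_eq_or_eq_neg.1 hy.symm
  rw [Measure.prod_apply hD]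
  simp only [h0, lintegral_zero]

/-- `Prod.swap` preserves `γ ⊗ γ`, so the two strict events have the same probability. -/
theorem gaussPair_swap :
    ((gaussianReal 0 1).prod (gaussianReal 0 1)) {q : ℝ × ℝ | q.2 ^ 2 < q.1 ^ 2} =
      ((gaussianReal 0 1).prod (gaussianReal 0 1)) {q : ℝ × ℝ | q.1 ^ 2 < q.2 ^ 2} := by
  have hA : MeasurableSet {q : ℝ × ℝ | q.1 ^ 2 < q.2 ^ 2} :=
    measurableSet_lt (by fun_prop) (by fun_prop)
  calc ((gaussianReal 0 1).prod (gaussianReal 0 1)) {q : ℝ × ℝ | q.2 ^ 2 < q.1 ^ 2}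
      = ((gaussianReal 0 1).prod (gaussianReal 0 1))
          (Prod.swap ⁻¹' {q : ℝ × ℝ | q.1 ^ 2 < q.2 ^ 2}) := rfl
    _ = (((gaussianReal 0 1).prod (gaussianReal 0 1)).map Prod.swap)
          {q : ℝ × ℝ | q.1 ^ 2 < q.2 ^ 2} := (Measure.map_apply measurable_swap hA).symm
    _ = ((gaussianReal 0 1).prod (gaussianReal 0 1)) {q : ℝ × ℝ | q.1 ^ 2 < q.2 ^ 2} := by
          rw [Measure.prod_swap]

/-- `γ ⊗ γ {x² < y²} ≥ 1/2` (in fact `= 1/2`): the complement is `{y² < x²} ∪ {x² = y²}`. -/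
theorem gaussPair_half_le :
    (1 / 2 : ℝ) ≤
      ((gaussianReal 0 1).prod (gaussianReal 0 1)).real {q : ℝ × ℝ | q.1 ^ 2 < q.2 ^ 2} := by
  have hA : MeasurableSet {q : ℝ × ℝ | q.1 ^ 2 < q.2 ^ 2} :=
    measurableSet_lt (by fun_prop) (by fun_prop)
  have h1 := probReal_add_probReal_compl (μ := (gaussianReal 0 1).prod (gaussianReal 0 1)) hA
  have hcompl : {q : ℝ × ℝ | q.1 ^ 2 < q.2 ^ 2}ᶜ ⊆
      {q : ℝ × ℝ | q.2 ^ 2 < q.1 ^ 2} ∪ {q : ℝ × ℝ | q.1 ^ 2 = q.2 ^ 2} := by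
    intro q hq
    simp only [Set.mem_compl_iff, Set.mem_setOf_eq, not_lt] at hq
    rcases hq.lt_or_eq with h | h
    · exact Or.inl h
    · exact Or.inr h.symm
  have h2 : ((gaussianReal 0 1).prod (gaussianReal 0 1)).real {q : ℝ × ℝ | q.1 ^ 2 < q.2 ^ 2}ᶜ ≤
      ((gaussianReal 0 1).prod (gaussianReal 0 1)).real {q : ℝ × ℝ | q.1 ^ 2 < q.2 ^ 2} :=
    calc ((gaussianReal 0 1).prod (gaussianReal 0 1)).real {q : ℝ × ℝ | q.1 ^ 2 < q.2 ^ 2}ᶜ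
        ≤ ((gaussianReal 0 1).prod (gaussianReal 0 1)).real
            ({q : ℝ × ℝ | q.2 ^ 2 < q.1 ^ 2} ∪ {q : ℝ × ℝ | q.1 ^ 2 = q.2 ^ 2}) :=
          measureReal_mono hcompl
      _ ≤ ((gaussianReal 0 1).prod (gaussianReal 0 1)).real {q : ℝ × ℝ | q.2 ^ 2 < q.1 ^ 2} +
            ((gaussianReal 0 1).prod (gaussianReal 0 1)).real {q : ℝ × ℝ | q.1 ^ 2 = q.2 ^ 2} :=
          measureReal_union_le _ _
      _ = ((gaussianReal 0 1).prod (gaussianReal 0 1)).real {q : ℝ × ℝ | q.1 ^ 2 < q.2 ^ 2} := by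
          simp only [measureReal_def, gaussPair_swap, gaussPair_tie_null, ENNReal.toReal_zero,
            add_zero]
  linarith

/-- The swapped version: `γ ⊗ γ {y² < x²} ≥ 1/2`. -/
theorem gaussPair_half_le' :
    (1 / 2 : ℝ) ≤
      ((gaussianReal 0 1).prod (gaussianReal 0 1)).real {q : ℝ × ℝ | q.2 ^ 2 < q.1 ^ 2} := by
  rw [measureReal_def, gaussPair_swap, ← measureReal_def]
  exact gaussPair_half_le

/-- The box `[1, 6/5] × [6/5, 17/10]` lies inside `{x² ≤ y² < 3x²}`. -/
theorem gaussPair_box_subset :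
    Set.Icc (1 : ℝ) (6 / 5) ×ˢ Set.Icc (6 / 5 : ℝ) (17 / 10) ⊆
      {q : ℝ × ℝ | q.1 ^ 2 ≤ q.2 ^ 2} ∩ {q : ℝ × ℝ | q.2 ^ 2 < 3 * q.1 ^ 2} := by
  rintro ⟨x, y⟩ ⟨⟨hx1, hx2⟩, ⟨hy1, hy2⟩⟩
  simp only [Set.mem_inter_iff, Set.mem_setOf_eq]
  constructor <;> nlinarith

/-- `γ [a, b] > 0` for `a < b`, since `volume ≪ γ`. -/
theorem gaussPair_Icc_pos {a b : ℝ} (hab : a < b) :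
    0 < (gaussianReal 0 1).real (Set.Icc a b) := by
  rw [measureReal_def]
  refine ENNReal.toReal_pos (fun h => ?_) (measure_ne_top _ _)
  have h' := gaussianReal_absolutelyContinuous' 0 one_ne_zero h
  rw [Real.volume_Icc, ENNReal.ofReal_eq_zero] at h'
  linarith

/-- `γ ⊗ γ {y² < 3x²} ≥ 1/2 + κ` with `κ = γ [1, 6/5] · γ [6/5, 17/10]`. -/
theorem gaussPair_three :
    1 / 2 + (gaussianReal 0 1).real (Set.Icc 1 (6 / 5)) *
        (gaussianReal 0 1).real (Set.Icc (6 / 5) (17 / 10)) ≤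
      ((gaussianReal 0 1).prod (gaussianReal 0 1)).real
        {q : ℝ × ℝ | q.2 ^ 2 < 3 * q.1 ^ 2} := by
  have hB : MeasurableSet
      ({q : ℝ × ℝ | q.1 ^ 2 ≤ q.2 ^ 2} ∩ {q : ℝ × ℝ | q.2 ^ 2 < 3 * q.1 ^ 2}) :=
    (measurableSet_le (by fun_prop) (by fun_prop)).inter
      (measurableSet_lt (by fun_prop) (by fun_prop))
  have hdisj : Disjoint {q : ℝ × ℝ | q.2 ^ 2 < q.1 ^ 2}
      ({q : ℝ × ℝ | q.1 ^ 2 ≤ q.2 ^ 2} ∩ {q : ℝ × ℝ | q.2 ^ 2 < 3 * q.1 ^ 2}) := by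
    rw [Set.disjoint_left]
    rintro q hq ⟨hq1, -⟩
    simp only [Set.mem_setOf_eq] at hq hq1
    exact absurd hq (not_lt.2 hq1)
  have hsub : {q : ℝ × ℝ | q.2 ^ 2 < q.1 ^ 2} ∪
        ({q : ℝ × ℝ | q.1 ^ 2 ≤ q.2 ^ 2} ∩ {q : ℝ × ℝ | q.2 ^ 2 < 3 * q.1 ^ 2}) ⊆
      {q : ℝ × ℝ | q.2 ^ 2 < 3 * q.1 ^ 2} := by
    rintro q (hq | ⟨-, hq⟩)
    · simp only [Set.mem_setOf_eq] at hq ⊢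
      nlinarith [sq_nonneg q.1]
    · exact hq
  calc 1 / 2 + (gaussianReal 0 1).real (Set.Icc 1 (6 / 5)) *
          (gaussianReal 0 1).real (Set.Icc (6 / 5) (17 / 10))
      ≤ ((gaussianReal 0 1).prod (gaussianReal 0 1)).real {q : ℝ × ℝ | q.2 ^ 2 < q.1 ^ 2} +
          ((gaussianReal 0 1).prod (gaussianReal 0 1)).real
            (Set.Icc (1 : ℝ) (6 / 5) ×ˢ Set.Icc (6 / 5 : ℝ) (17 / 10)) :=
        add_le_add gaussPair_half_le' (measureReal_prod_prod _ _).symm.le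
    _ ≤ ((gaussianReal 0 1).prod (gaussianReal 0 1)).real {q : ℝ × ℝ | q.2 ^ 2 < q.1 ^ 2} +
          ((gaussianReal 0 1).prod (gaussianReal 0 1)).real
            ({q : ℝ × ℝ | q.1 ^ 2 ≤ q.2 ^ 2} ∩ {q : ℝ × ℝ | q.2 ^ 2 < 3 * q.1 ^ 2}) :=
        add_le_add le_rfl (measureReal_mono gaussPair_box_subset)
    _ = ((gaussianReal 0 1).prod (gaussianReal 0 1)).real ({q : ℝ × ℝ | q.2 ^ 2 < q.1 ^ 2} ∪
          ({q : ℝ × ℝ | q.1 ^ 2 ≤ q.2 ^ 2} ∩ {q : ℝ × ℝ | q.2 ^ 2 < 3 * q.1 ^ 2})) :=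
        (measureReal_union hdisj hB).symm
    _ ≤ ((gaussianReal 0 1).prod (gaussianReal 0 1)).real
          {q : ℝ × ℝ | q.2 ^ 2 < 3 * q.1 ^ 2} := measureReal_mono hsub

/-! ### The pair `(⟪U, ·⟫, ⟪V, ·⟫)` under `stdGaussian (EuclideanSpace ℝ (Fin n))` -/

variable {n : ℕ}

/-- Marginal: the law of `⟪W, ·⟫` under `stdGaussian` is `N(0, ‖W‖²)`, the image of `γ` under
`x ↦ ‖W‖ x`. -/
theorem gaussPair_marginal (W : EuclideanSpace ℝ (Fin n)) :
    (stdGaussian (EuclideanSpace ℝ (Fin n))).map (fun c => ⟪W, c⟫) =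
      (gaussianReal 0 1).map (fun x : ℝ => ‖W‖ * x) := by
  have h := IsGaussian.map_eq_gaussianReal (μ := stdGaussian (EuclideanSpace ℝ (Fin n)))
    (innerSL ℝ W)
  rw [integral_strongDual_stdGaussian, variance_dual_stdGaussian, innerSL_apply_norm,
    coe_innerSL_apply] at h
  rw [h, gaussianReal_map_const_mul, mul_zero, mul_one, Real.toNNReal_of_nonneg (sq_nonneg _)]

/-- Joint law: for `U ⊥ V`, the law of `(⟪U, ·⟫, ⟪V, ·⟫)` under `stdGaussian` is the image of
`γ ⊗ γ` under `(x, y) ↦ (‖U‖ x, ‖V‖ y)`. -/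
theorem gaussPair_jointLaw (U V : EuclideanSpace ℝ (Fin n)) (hUV : ⟪U, V⟫ = 0) :
    (stdGaussian (EuclideanSpace ℝ (Fin n))).map (fun c => (⟪U, c⟫, ⟪V, c⟫)) =
      ((gaussianReal 0 1).prod (gaussianReal 0 1)).map
        (Prod.map (fun x : ℝ => ‖U‖ * x) (fun y : ℝ => ‖V‖ * y)) := by
  have hL : (fun c : EuclideanSpace ℝ (Fin n) => (⟪U, c⟫, ⟪V, c⟫)) =
      ⇑((innerSL ℝ U).prod (innerSL ℝ V)) := rfl
  have hXY : HasGaussianLaw (fun c : EuclideanSpace ℝ (Fin n) => (⟪U, c⟫, ⟪V, c⟫))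
      (stdGaussian (EuclideanSpace ℝ (Fin n))) := by
    rw [hL]
    exact IsGaussian.hasGaussianLaw
  have hind : IndepFun (fun c : EuclideanSpace ℝ (Fin n) => ⟪U, c⟫) (fun c => ⟪V, c⟫)
      (stdGaussian (EuclideanSpace ℝ (Fin n))) := by
    refine hXY.indepFun_of_covariance_eq_zero ?_
    rw [← covarianceBilin_apply_eq_cov IsGaussian.memLp_two_id, covarianceBilin_stdGaussian,
      innerSL_apply_apply, hUV]
  rw [(indepFun_iff_map_prod_eq_prod_map_map (by fun_prop) (by fun_prop)).1 hind,
    gaussPair_marginal U, gaussPair_marginal V,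
    Measure.map_prod_map _ _ (measurable_const_mul _) (measurable_const_mul _)]

/-- Transfer of events: `P[(⟪U, c⟫, ⟪V, c⟫) ∈ S] = γ ⊗ γ {(x, y) | (‖U‖ x, ‖V‖ y) ∈ S}`. -/
theorem gaussPair_transfer (U V : EuclideanSpace ℝ (Fin n)) (hUV : ⟪U, V⟫ = 0)
    {S : Set (ℝ × ℝ)} (hS : MeasurableSet S) :
    (stdGaussian (EuclideanSpace ℝ (Fin n))).real {c | (⟪U, c⟫, ⟪V, c⟫) ∈ S} =
      ((gaussianReal 0 1).prod (gaussianReal 0 1)).real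
        {q : ℝ × ℝ | (‖U‖ * q.1, ‖V‖ * q.2) ∈ S} := by
  have hm : Measurable (fun c : EuclideanSpace ℝ (Fin n) => (⟪U, c⟫, ⟪V, c⟫)) := by fun_prop
  have hm' : Measurable (Prod.map (fun x : ℝ => ‖U‖ * x) (fun y : ℝ => ‖V‖ * y)) :=
    (measurable_const_mul _).prodMap (measurable_const_mul _)
  calc (stdGaussian (EuclideanSpace ℝ (Fin n))).real {c | (⟪U, c⟫, ⟪V, c⟫) ∈ S}
      = ((stdGaussian (EuclideanSpace ℝ (Fin n))).map (fun c => (⟪U, c⟫, ⟪V, c⟫))).real S :=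
        (map_measureReal_apply hm hS).symm
    _ = (((gaussianReal 0 1).prod (gaussianReal 0 1)).map
          (Prod.map (fun x : ℝ => ‖U‖ * x) (fun y : ℝ => ‖V‖ * y))).real S := by
        rw [gaussPair_jointLaw U V hUV]
    _ = ((gaussianReal 0 1).prod (gaussianReal 0 1)).real
          {q : ℝ × ℝ | (‖U‖ * q.1, ‖V‖ * q.2) ∈ S} := map_measureReal_apply hm' hS

/-! ### The registered stub -/

/-- **Stub G (`Stmt.gaussPair`).** For the standard Gaussian `c` on `ℝⁿ` and orthogonal `U, V`
with `U ≠ 0`: if `‖U‖ = ‖V‖` then `⟨c,U⟩² < ⟨c,V⟩²` with probability `≥ 1/2`; and for the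
absolute constant `κ = γ [1, 6/5] · γ [6/5, 17/10] > 0` (`γ = N(0,1)`), if `‖U‖² ≥ 3‖V‖²` then
`⟨c,V⟩² < ⟨c,U⟩²` with probability `≥ 1/2 + κ`. -/
theorem stub_gaussPair :
    ∃ κ : ℝ, 0 < κ ∧ ∀ (n : ℕ) (U V : EuclideanSpace ℝ (Fin n)), inner ℝ U V = 0 → 0 < ‖U‖ →
      (‖U‖ = ‖V‖ →
        (1 / 2 : ℝ) ≤ (stdGaussian (EuclideanSpace ℝ (Fin n))).real
          {c | inner ℝ c U ^ 2 < inner ℝ c V ^ 2}) ∧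
      (3 * ‖V‖ ^ 2 ≤ ‖U‖ ^ 2 →
        1 / 2 + κ ≤ (stdGaussian (EuclideanSpace ℝ (Fin n))).real
          {c | inner ℝ c V ^ 2 < inner ℝ c U ^ 2}) := by
  refine ⟨(gaussianReal 0 1).real (Set.Icc 1 (6 / 5)) *
      (gaussianReal 0 1).real (Set.Icc (6 / 5) (17 / 10)),
    mul_pos (gaussPair_Icc_pos (by norm_num)) (gaussPair_Icc_pos (by norm_num)), ?_⟩
  intro n U V hUV hU
  refine ⟨fun hnorm => ?_, fun h3 => ?_⟩
  · have hA : MeasurableSet {p : ℝ × ℝ | p.1 ^ 2 < p.2 ^ 2} :=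
      measurableSet_lt (by fun_prop) (by fun_prop)
    have hset : {c : EuclideanSpace ℝ (Fin n) | ⟪c, U⟫ ^ 2 < ⟪c, V⟫ ^ 2} =
        {c | (⟪U, c⟫, ⟪V, c⟫) ∈ {p : ℝ × ℝ | p.1 ^ 2 < p.2 ^ 2}} := by
      ext c
      simp only [Set.mem_setOf_eq]
      rw [real_inner_comm U c, real_inner_comm V c]
    have hset' : {q : ℝ × ℝ | (‖U‖ * q.1, ‖V‖ * q.2) ∈ {p : ℝ × ℝ | p.1 ^ 2 < p.2 ^ 2}} =
        {q : ℝ × ℝ | q.1 ^ 2 < q.2 ^ 2} := by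
      ext q
      simp only [Set.mem_setOf_eq, ← hnorm, mul_pow]
      exact mul_lt_mul_iff_right₀ (by positivity)
    rw [hset, gaussPair_transfer U V hUV hA, hset']
    exact gaussPair_half_le
  · have hA : MeasurableSet {p : ℝ × ℝ | p.2 ^ 2 < p.1 ^ 2} :=
      measurableSet_lt (by fun_prop) (by fun_prop)
    have hset : {c : EuclideanSpace ℝ (Fin n) | ⟪c, V⟫ ^ 2 < ⟪c, U⟫ ^ 2} =
        {c | (⟪U, c⟫, ⟪V, c⟫) ∈ {p : ℝ × ℝ | p.2 ^ 2 < p.1 ^ 2}} := by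
      ext c
      simp only [Set.mem_setOf_eq]
      rw [real_inner_comm U c, real_inner_comm V c]
    have hsub : {q : ℝ × ℝ | q.2 ^ 2 < 3 * q.1 ^ 2} ⊆
        {q : ℝ × ℝ | (‖U‖ * q.1, ‖V‖ * q.2) ∈ {p : ℝ × ℝ | p.2 ^ 2 < p.1 ^ 2}} := by
      intro q hq
      simp only [Set.mem_setOf_eq] at hq ⊢
      rw [mul_pow, mul_pow]
      have hU2 : 0 < ‖U‖ ^ 2 := by positivity
      calc ‖V‖ ^ 2 * q.2 ^ 2 ≤ ‖U‖ ^ 2 / 3 * q.2 ^ 2 := by gcongr; linarith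
        _ < ‖U‖ ^ 2 * q.1 ^ 2 := by nlinarith
    rw [hset, gaussPair_transfer U V hUV hA]
    exact gaussPair_three.trans (measureReal_mono hsub)

end Summit.ValiantsHypothesis.ValiantsHypothesis.Theorems.SOSTauSOSTau
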